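import Literature.Algebra.Homology.TateNakayamaInflationVanishingPlain
import Mathlib.LinearAlgebra.Contraction
import HarnessLib

/-!
# Milne I Lemma 1.9's engine with `Hom`-coefficients: every class of `Hⁿ⁺³(G, Hom(N, C))`, `N` a
# `G`-lattice, dies under an inflation `Inf_π` with `Inf_π[φ] = d·[φ₁]`, `|G| ∣ d`
# (Milne ADT I Lemma 1.9; Harari Lemma 16.20, Prop. 16.16 (b))

Topic `Algebra/Homology`; namespace `Literature.Algebra.Homology`.  Definitions with bodies (`dualRep`, the
`G`-equivariant `C ⊗ N^∨ ≅ Hom(N, C)` for a lattice `N`, and the comparison map `C₁ ⊗ Res N^∨ → Hom(N₁, C₁)`) and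
theorems; no named fact, no instance, no `sorry`.  Sequel of `TateNakayamaCupProductInflation` (door-c6 g11:
`IsClassModule.map_eq_zero_of_card_dvd`, coefficients `C ⊗ N'` with `N'` torsion-free) and
`TateNakayamaInflationVanishingPlain` (door-c6 g15).

THE POINT.  Milne's proof of ADT I Lemma 1.9 computes `Extʳ_G(M, C) = lim→ Hʳ(G/U, Hom(M, C^U))` for `M` of finite
type and kills the transition maps by Tate–Nakayama; the cell's engine is stated with TENSOR coefficients `C ⊗ N'`.
For a `G`-LATTICE `N` (finitely generated free `k`-module) the conjugation representation `Hom_k(N, C)` (Mathlib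
`Rep.ihom`, Harari Def. 16.10) is `C ⊗ N^∨` (`tensorDualIso`, the equivariant form of Mathlib's
`dualTensorHomEquivOfBasis`; equivariance = Mathlib's `Representation.dualTensorHom_comm` up to the symmetry), so the
engine transports: **`IsClassModule.map_ihom_eq_zero_of_card_dvd`** — for a class module `(G, C, [φ])` (`G` finite), a
`G`-lattice `N`, `π : G₁ → G`, `ι : Res_π C → C₁` with `Inf_π[φ] = d·[φ₁]`, `|G| ∣ d`, and ANY `G₁`-module `N₁`
identified with `Res_π N` by a linear isomorphism `e` (`e (g·x) = π(g)·e(x)`), the map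
`Hⁿ⁺³(G, Hom(N, C)) → Hⁿ⁺³(G₁, Hom(N₁, C₁))` along `(π, F ↦ ι ∘ F ∘ e)` is ZERO.  (The freedom in `N₁` is what
the layer systems of the idèle class formation need: the coefficient lattice at a deeper layer is only
propositionally the restriction of the one above.)

## References
* J. S. Milne, *Arithmetic Duality Theorems* (2nd ed. 2006), I §1, Lemma 1.9 (proof). [MilneADT2006]
* D. Harari, *Galois Cohomology and Class Field Theory* (2020), §16.2 Def. 16.10, Prop. 16.16 (b); §16.3 Lemma
  16.20. [Harari2020]
* K. S. Brown, *Cohomology of Groups*, GTM 87 (1982), III §8. [Brown1982CohomologyGroups]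
-/

noncomputable section

namespace Literature.Algebra.Homology

open CategoryTheory CategoryTheory.MonoidalCategory groupCohomology

universe u

/-! ## §1 `C ⊗ N^∨ ≅ Hom(N, C)` for a lattice `N`, equivariantly -/

section DualTensor

variable {k G : Type u} [CommRing k] [Group G] (C N : Rep.{u} k G)

/-- The contragredient (dual) representation `N^∨ = Hom_k(N, k)` (Mathlib `Representation.dual`), as an object
of `Rep k G`. [cite: Harari2020, §16.2 Definition 16.10] -/
abbrev dualRep : Rep.{u} k G := Rep.of N.ρ.dual

/-- The `k`-linear map `C ⊗ N^∨ → Hom_k(N, C)`, `c ⊗ f ↦ (x ↦ f x • c)` (Mathlib `dualTensorHom` after the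
symmetry). [cite: Harari2020, §16.2 Proposition 16.16 (b)] -/
def tensorDualLinearMap : (C ⊗ dualRep N : Rep k G).V →ₗ[k] (N.V →ₗ[k] C.V) :=
  dualTensorHom k N.V C.V ∘ₗ (TensorProduct.comm k C.V (Module.Dual k N.V)).toLinearMap

/-- Formula on pure tensors. [cite: Harari2020, §16.2 Proposition 16.16 (b)] -/
@[simp]
theorem tensorDualLinearMap_tmul (c : C.V) (f : Module.Dual k N.V) (x : N.V) :
    tensorDualLinearMap C N (c ⊗ₜ f) x = f x • c := rfl

/-- **Equivariance**: `c ⊗ f ↦ (x ↦ f x • c)` intertwines `ρ_C ⊗ ρ_N^∨` with the conjugation action on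
`Hom_k(N, C)` (Mathlib `Representation.dualTensorHom_comm`, after the symmetry).
[cite: Harari2020, §16.2 Definition 16.10] -/
theorem tensorDualLinearMap_comm (g : G) :
    tensorDualLinearMap C N ∘ₗ (C ⊗ dualRep N : Rep k G).ρ g =
      ((Rep.ihom N).obj C).ρ g ∘ₗ tensorDualLinearMap C N := by
  refine TensorProduct.ext' fun c f => LinearMap.ext fun x => ?_
  change tensorDualLinearMap C N ((C.ρ.tprod N.ρ.dual) g (c ⊗ₜ f)) x =
    (C.ρ g ∘ₗ tensorDualLinearMap C N (c ⊗ₜ f) ∘ₗ N.ρ g⁻¹) x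
  rw [Representation.tprod_apply, TensorProduct.map_tmul, tensorDualLinearMap_tmul, LinearMap.comp_apply,
    LinearMap.comp_apply, tensorDualLinearMap_tmul, map_smul, Representation.dual_apply,
    Module.Dual.transpose_apply, LinearMap.comp_apply]

/-- `c ⊗ f ↦ (x ↦ f x • c)` as a morphism `C ⊗ N^∨ ⟶ Hom(N, C)` of `Rep k G`.
[cite: Harari2020, §16.2 Proposition 16.16 (b)] -/
def tensorDualHom : C ⊗ dualRep N ⟶ (Rep.ihom N).obj C :=
  Rep.ofHom ⟨tensorDualLinearMap C N, tensorDualLinearMap_comm C N⟩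

/-- Formula. [cite: Harari2020, §16.2 Proposition 16.16 (b)] -/
@[simp]
theorem tensorDualHom_hom_apply (t : (C ⊗ dualRep N : Rep k G).V) :
    (tensorDualHom C N).hom t = tensorDualLinearMap C N t := rfl

variable [Module.Free k N.V] [Module.Finite k N.V]

/-- For a lattice `N` (finitely generated free over `k`), `c ⊗ f ↦ (x ↦ f x • c)` is bijective (Mathlib
`dualTensorHomEquivOfBasis`). [cite: Harari2020, §16.2 Proposition 16.16 (b)] -/
theorem tensorDualLinearMap_bijective : Function.Bijective (tensorDualLinearMap C N) := by
  let b := Module.Free.chooseBasis k N.V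
  have h : ⇑(tensorDualLinearMap C N) =
      (dualTensorHomEquivOfBasis (N := C.V) b) ∘ (TensorProduct.comm k C.V (Module.Dual k N.V)) := by
    funext t
    rw [Function.comp_apply, dualTensorHomEquivOfBasis_apply]
    rfl
  rw [h]
  exact (dualTensorHomEquivOfBasis (N := C.V) b).bijective.comp (TensorProduct.comm k _ _).bijective

/-- **`C ⊗ N^∨ ≅ Hom_k(N, C)` in `Rep k G` for a `G`-lattice `N`.** [cite: Harari2020, §16.2 Proposition 16.16 (b)] -/
def tensorDualIso : C ⊗ dualRep N ≅ (Rep.ihom N).obj C :=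
  Rep.mkIso (Representation.Equiv.mk (LinearEquiv.ofBijective (tensorDualLinearMap C N)
    (tensorDualLinearMap_bijective C N)) (tensorDualLinearMap_comm C N))

omit [Module.Free k N.V] [Module.Finite k N.V] in
/-- The isomorphism is `tensorDualHom` on vectors. [cite: Harari2020, §16.2 Proposition 16.16 (b)] -/
theorem tensorDualIso_hom [Module.Free k N.V] [Module.Finite k N.V] :
    (tensorDualIso C N).hom = tensorDualHom C N := rfl

/-- `Hⁿ(G, Hom(N, C))` is reached from `Hⁿ(G, C ⊗ N^∨)`: the map along `tensorDualHom` is onto.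
[cite: Harari2020, §16.2 Proposition 16.16 (b)] -/
theorem map_tensorDualHom_surjective (n : ℕ) :
    Function.Surjective (map (A := C ⊗ dualRep N) (MonoidHom.id G) (tensorDualHom C N) n) := fun y => by
  refine ⟨map (A := (Rep.ihom N).obj C) (B := C ⊗ dualRep N) (MonoidHom.id G) (tensorDualIso C N).inv n y, ?_⟩
  rw [← CategoryTheory.comp_apply, ← map_id_comp, ← tensorDualIso_hom, Iso.inv_hom_id]
  erw [map_id]
  rfl

end DualTensor

/-! ## §2 The comparison map at the deeper layer and the commuting square -/

section Compare

variable {k : Type u} [CommRing k] {G₁ G₂ : Type u} [Group G₁] [Group G₂] (π : G₁ →* G₂)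
  (C₂ N₂ : Rep.{u} k G₂) (C₁ N₁ : Rep.{u} k G₁) (ι : Rep.res π C₂ ⟶ C₁)
  (e : N₁.V ≃ₗ[k] N₂.V) (he : ∀ (g : G₁) (x : N₁.V), e (N₁.ρ g x) = N₂.ρ (π g) (e x))

/-- **The transition `Hom(N₂, C₂) → Hom(N₁, C₁)`, `F ↦ ι ∘ F ∘ e`**, as a morphism
`Res_π Hom(N₂, C₂) ⟶ Hom(N₁, C₁)` of `G₁`-modules (`e : N₁ ≅ Res_π N₂` linear, `π`-equivariant).
[cite: Harari2020, §16.2 Definition 16.11] -/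
def ihomTransition : Rep.res π ((Rep.ihom N₂).obj C₂) ⟶ (Rep.ihom N₁).obj C₁ :=
  Rep.ofHom ⟨(LinearMap.llcomp k N₁.V C₂.V C₁.V ι.hom.toLinearMap) ∘ₗ
      (LinearMap.lcomp k C₂.V e.toLinearMap), fun g => LinearMap.ext fun F => LinearMap.ext fun x => by
    change ι.hom (C₂.ρ (π g) ((show N₂.V →ₗ[k] C₂.V from F) (N₂.ρ (π g)⁻¹ (e x)))) =
      C₁.ρ g (ι.hom ((show N₂.V →ₗ[k] C₂.V from F) (e (N₁.ρ g⁻¹ x))))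
    rw [he, map_inv π g]
    exact Rep.hom_comm_apply ι g _⟩

/-- Formula: `ihomTransition F = ι ∘ F ∘ e`. [cite: Harari2020, §16.2 Definition 16.11] -/
theorem ihomTransition_hom_apply (F : N₂.V →ₗ[k] C₂.V) :
    (ihomTransition π C₂ N₂ C₁ N₁ ι e he).hom F = ι.hom.toLinearMap ∘ₗ F ∘ₗ e.toLinearMap := rfl

/-- Formula, evaluated: `(ihomTransition F) x = ι (F (e x))`. [cite: Harari2020, §16.2 Definition 16.11] -/
theorem ihomTransition_hom_apply_apply (F : N₂.V →ₗ[k] C₂.V) (x : N₁.V) :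
    (ι.hom.toLinearMap ∘ₗ F ∘ₗ e.toLinearMap) x = ι.hom (F (e x)) := rfl

/-- **The comparison `C₁ ⊗ Res_π N₂^∨ → Hom(N₁, C₁)`**, `c ⊗ f ↦ (x ↦ f (e x) • c)`, a morphism of `G₁`-modules
(on vectors it is `tensorDualLinearMap C₁ (Res_π N₂)` followed by `(· ∘ e)`).
[cite: Harari2020, §16.2 Proposition 16.16 (b)] -/
def tensorDualResHom : C₁ ⊗ Rep.res π (dualRep N₂) ⟶ (Rep.ihom N₁).obj C₁ :=
  Rep.ofHom ⟨(LinearMap.lcomp k C₁.V e.toLinearMap) ∘ₗ tensorDualLinearMap C₁ (Rep.res π N₂),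
    fun g => by
      refine TensorProduct.ext' fun c f => LinearMap.ext fun x => ?_
      change (N₂.ρ.dual (π g) f) (e x) • C₁.ρ g c = C₁.ρ g (f (e (N₁.ρ g⁻¹ x)) • c)
      rw [map_smul, Representation.dual_apply, Module.Dual.transpose_apply, LinearMap.comp_apply, he,
        map_inv π g]⟩

/-- Formula. [cite: Harari2020, §16.2 Proposition 16.16 (b)] -/
theorem tensorDualResHom_hom_tmul (c : C₁.V) (f : Module.Dual k N₂.V) :
    (tensorDualResHom π N₂ C₁ N₁ e he).hom (c ⊗ₜ f) =
      tensorDualLinearMap C₁ (Rep.res π N₂) (c ⊗ₜ f) ∘ₗ e.toLinearMap := rfl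

/-- **The square** `Res_π(C₂ ⊗ N₂^∨ → Hom(N₂, C₂)) ≫ (F ↦ ι ∘ F ∘ e) = (Res(C₂ ⊗ N₂^∨) → C₁ ⊗ Res N₂^∨) ≫ (C₁ ⊗ Res N₂^∨ → Hom(N₁, C₁))`,
as linear maps (both send `c ⊗ f` to `x ↦ f (e x) • ι c`). [cite: Harari2020, §16.2 Proposition 16.16 (b)] -/
theorem ihomTransition_comp_tensorDualLinearMap :
    (ihomTransition π C₂ N₂ C₁ N₁ ι e he).hom.toLinearMap ∘ₗ tensorDualLinearMap C₂ N₂ =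
      (tensorDualResHom π N₂ C₁ N₁ e he).hom.toLinearMap ∘ₗ
        ((ι ⊗ₘ 𝟙 (Rep.res π (dualRep N₂))).hom.toLinearMap ∘ₗ (resTensorHom C₂ (dualRep N₂) π).hom.toLinearMap) :=
  TensorProduct.ext' fun c f => LinearMap.ext fun x => by
    change ι.hom ((tensorDualLinearMap C₂ N₂ (c ⊗ₜ f)) (e x)) =
      (tensorDualLinearMap C₁ (Rep.res π N₂) (ι.hom c ⊗ₜ f)) (e x)
    rw [tensorDualLinearMap_tmul, tensorDualLinearMap_tmul, map_smul]

/-- The square, pointwise. [cite: Harari2020, §16.2 Proposition 16.16 (b)] -/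
theorem ihomTransition_hom_tensorDualLinearMap (t : (C₂ ⊗ dualRep N₂ : Rep k G₂).V) :
    (ihomTransition π C₂ N₂ C₁ N₁ ι e he).hom (tensorDualLinearMap C₂ N₂ t) =
      (tensorDualResHom π N₂ C₁ N₁ e he).hom
        ((ι ⊗ₘ 𝟙 (Rep.res π (dualRep N₂))).hom ((resTensorHom C₂ (dualRep N₂) π).hom t)) :=
  LinearMap.congr_fun (ihomTransition_comp_tensorDualLinearMap π C₂ N₂ C₁ N₁ ι e he) t

/-- **On cohomology**: `Hⁿ(𝟙, C₂ ⊗ N₂^∨ → Hom) ≫ Hⁿ(π, F ↦ ι∘F∘e) = Hⁿ(π, Res(C₂ ⊗ N₂^∨) → C₁ ⊗ Res N₂^∨) ≫ Hⁿ(𝟙, C₁ ⊗ Res N₂^∨ → Hom)`.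
[cite: Brown1982CohomologyGroups, III §8] -/
theorem map_tensorDualHom_comp_map_ihomTransition (n : ℕ) :
    map (A := C₂ ⊗ dualRep N₂) (MonoidHom.id G₂) (tensorDualHom C₂ N₂) n ≫
        map π (ihomTransition π C₂ N₂ C₁ N₁ ι e he) n =
      map π (resTensorHom C₂ (dualRep N₂) π ≫ (ι ⊗ₘ 𝟙 (Rep.res π (dualRep N₂)))) n ≫
        map (A := C₁ ⊗ Rep.res π (dualRep N₂)) (MonoidHom.id G₁) (tensorDualResHom π N₂ C₁ N₁ e he) n := by
  rw [← map_comp, ← map_comp]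
  exact map_congr' (MonoidHom.ext fun _ => rfl) _ _
    (fun t => ihomTransition_hom_tensorDualLinearMap π C₂ N₂ C₁ N₁ ι e he t) n

end Compare

/-! ## §3 Class modules: every class of `Hⁿ⁺³(G, Hom(N, C))` dies under `Inf_π` -/

section ClassModule

variable {G : Type} [Group G] [Fintype G] {C : Rep.{0} ℤ G} {φ : cocycles₂ C}
variable {G₁ : Type} [Group G₁] (π : G₁ →* G) {C₁ : Rep.{0} ℤ G₁} (ι : Rep.res π C ⟶ C₁)

/-- **Milne I Lemma 1.9 / Harari Lemma 16.20, finite-layer engine with `Hom`-coefficients: EVERY class of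
`Hⁿ⁺³(G, Hom(N, C))` dies under an inflation `Inf_π` with `Inf_π[φ] = d·[φ₁]`, `|G| ∣ d`.**  For a class module `C`
of the finite group `G` with fundamental class `[φ]`, a `G`-lattice `N` (finitely generated free abelian group), a
homomorphism `π : G₁ → G`, a `G₁`-module `C₁` with a `2`-cocycle `φ₁` and a `G₁`-map `ι : Res_π C → C₁` such that
`Inf_π[φ] = d·[φ₁]` and `|G| ∣ d`, and a `G₁`-lattice `N₁` identified with `Res_π N` by `e` (`e (g·x) = π(g)·e(x)`):
the map `Hⁿ⁺³(G, Hom(N, C)) → Hⁿ⁺³(G₁, Hom(N₁, C₁))` along `(π, F ↦ ι ∘ F ∘ e)` vanishes identically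
(`Hom(N, C) ≅ C ⊗ N^∨` and `IsClassModule.map_eq_zero_of_card_dvd` for the torsion-free `N^∨`).
[cite: MilneADT2006, I Lemma 1.9][cite: Harari2020, §16.3 Lemma 16.20] -/
theorem IsClassModule.map_ihom_eq_zero_of_card_dvd (hC : IsClassModule C φ) (N : Rep.{0} ℤ G)
    [@Module.Free ℤ N.V _ _ N.hV2] [@Module.Finite ℤ N.V _ _ N.hV2] (φ₁ : cocycles₂ C₁) {d : ℕ}
    (hι : map π ι 2 (H2π C φ) = d • H2π C₁ φ₁) (hd : Nat.card G ∣ d)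
    (N₁ : Rep.{0} ℤ G₁)
    -- the `Module ℤ` structures are the ones the `Rep` objects carry (not `AddCommGroup.toIntModule`)
    (e : letI := N₁.hV2; letI := N.hV2; N₁.V ≃ₗ[ℤ] N.V)
    (he : ∀ (g : G₁) (x : N₁.V), e (N₁.ρ g x) = N.ρ (π g) (e x))
    (n : ℕ) (y : groupCohomology ((Rep.ihom N).obj C) (n + 3)) :
    map π (ihomTransition π C N C₁ N₁ ι e he) (n + 3) y = 0 := by
  haveI : IsAddTorsionFree (dualRep N).V := ⟨fun {m} hm f g hfg => by
    letI := N.hV2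
    exact LinearMap.ext fun x => nsmul_right_injective hm (LinearMap.congr_fun hfg x)⟩
  obtain ⟨y', rfl⟩ := map_tensorDualHom_surjective C N (n + 3) y
  rw [← CategoryTheory.comp_apply, map_tensorDualHom_comp_map_ihomTransition, CategoryTheory.comp_apply,
    hC.map_eq_zero_of_card_dvd π ι (dualRep N) φ₁ hι hd n y', map_zero]

end ClassModule

end Literature.Algebra.Homology

end
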